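import Summits.QuantumFields.BalabanUV.Beta.CovariantBoxPoincareGauge
import Literature.MathematicalPhysics.QuantumFieldTheory.Balaban1983to89.B9Thm37GlueTorusRW

/-!
# Beta / CombGaugeComparison — THE GAUGE-COMPARISON DATUM OF THE |A|-HALF ROUTE FOR CONTOUR TRANSPORTS: along pv21's comb
# (`B9Thm37GlueTorusCov.Comb`, transports `tr x = tr(parent x)·Rm(pbond x)` = the contour variables `R(U(Γ_{y,x}))` of [B9] (3.19)),
# a gauge `g` whose gauged comb-bond variables `g(parent)·Rm(pbond)·g(x)ᵀ` are `ε`-close to `1` satisfies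
# `‖g(x)·tr(x)ᵀ − g(base)‖ ≤ depth(x)·ε` — the hypothesis `hcmp` of part (E) (`CovariantBoxPoincareGauge.cmpD` with `O = g(base)`)
# with `δ = D·ε` for combs of depth `≤ D` (`D = ν(n−1)` for cube combs ⟹ `δ = O(1)νMα₀` when `ε = O(1)Mα₀/n`)
# (unit `b2b-balaban-beta-d4-p2`, GEN 7, MODEL crew; claim «MULTISCALE-POINCARE-MODEL» journal l.16779∕l.17773, part (G))

HONEST FRAMING: discharging `BetaPertH` makes Bałaban's UV stability UNCONDITIONAL — NOT the continuum limit, NOT the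
Clay problem.  HONEST DEPENDENCY (verbatim): «continuum YM on T⁴ ⇐ BetaPertH ∧ nine spine estimates (0/9 proved);
BetaPertH ⇐ (D1) ∧ (D4) ∧ CAP+tail; G-an2-4 gates asym, D1 and NE2/3/4.»  THIS MODULE DISCHARGES NOTHING of `BetaPertH`,
asserts NOTHING printed and cites nothing as a fact (ABSOLUTE RULE): [folklore] linear algebra along the pv21 MODEL comb
(`Comb`, `Comb.tr`, bond matrices `Rm` and a site gauge `g` as DATA).  SHAPES located at [B9] = `Balaban1985BackgroundPropagators`
(3.19) p. 393 (contour variables), (3.35) p. 396 (the small gauge on a cube).  No class change on row D4 (critical-path width 0;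
D4 DISCHARGE NO DATE); NOT BetaPertH, NOT continuum, NOT Clay, NOT summit progress.

THE MECHANISM.  `D(x) := g(x)·tr(x)ᵀ − g(base)` obeys `D(x) = k_x·D(parent x) + (k_x − 1)·g(base)` with `k_x` the TRANSPOSE of the
gauged comb-bond variable `h_x = g(parent)·Rm(pbond x)·g(x)ᵀ`; `k_x` is an isometry, `‖(k_x − 1)w‖ = ‖(h_x − 1)ᵀw‖ ≤ ε‖w‖`
(the transpose has the same defect — Cauchy–Schwarz), so `‖D(x)u‖ ≤ ‖D(parent x)u‖ + ε‖u‖` and induction on the depth.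

CONTENT (kernel, 0 sorry).  §1 component tools: `transpose_defect_le` (a defect bound passes to the transpose), `ns_add_le`
(square-root-free Minkowski), transposed isometry.  §2 the comb objects `cmpC` (= part (E)'s `cmpD` for charts into one block)
and `gbond` (the gauged comb-bond variable, part (B)'s `hol` shape), the one-step identity `cmpC_step`.  §3 END **`cmpC_le_depth`**:
`Σ_a(Σ_j D(x)_{aj}u_j)² ≤ (depth(x)·ε)²·Σu²`, and the chart form **`hcmp_of_comb`** (the `hcmp` hypothesis of
`covariant_box_poincare_gauge`∕`cell_bound_gauge` with `δ = D·ε`); v1.1: the BLOCK-LOCAL forms `cmpC_le_depth_on`,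
`hcmp_of_comb_on` (gauge hypothesis on the comb bonds of ONE block only — what a per-cube (3.35) gauge supplies).
-/

namespace Summit.QuantumFields.BalabanUV.Beta.CombGaugeComparison

open Finset Function
open Summit.QuantumFields.BalabanUV.Beta.BoxPoincare
open Summit.QuantumFields.BalabanUV.Beta.CovariantBoxPoincare
open Summit.QuantumFields.BalabanUV.Beta.CovariantBoxPoincareGauge
open Literature.MathematicalPhysics.QuantumFieldTheory.Balaban1983to89.B9Thm37GlueTorusCov (Comb)
open Literature.MathematicalPhysics.QuantumFieldTheory.Balaban1983to89.B9Thm37GlueTorusCovComp (mmul mmul_apply mmul_orth)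
open Literature.MathematicalPhysics.QuantumFieldTheory.Balaban1983to89.B9Thm37GlueTorusCovLevelsPoinc (sum_sq_orth_apply)
open Literature.MathematicalPhysics.QuantumFieldTheory.Balaban1983to89.B9Thm37GlueTorusRW (rows_orth)

noncomputable section

variable {Cp : Type} [Fintype Cp]

/-! ## §1 Component tools -/

/-- **A defect bound passes to the transpose** (Cauchy–Schwarz): if `‖Mw‖ ≤ ε‖w‖` for all `w` then `‖Mᵀu‖ ≤ ε‖u‖` for all `u`
(square form). [folklore] -/
theorem transpose_defect_le {M : Cp → Cp → ℝ} {ε : ℝ}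
    (hM : ∀ w : Cp → ℝ, ∑ a, (∑ j, M a j * w j) ^ 2 ≤ ε ^ 2 * ∑ j, w j ^ 2) (u : Cp → ℝ) :
    ∑ j, (∑ a, M a j * u a) ^ 2 ≤ ε ^ 2 * ∑ a, u a ^ 2 := by
  set w : Cp → ℝ := fun j => ∑ a, M a j * u a with hw
  set S : ℝ := ∑ j, w j ^ 2 with hS
  have hS0 : 0 ≤ S := sum_nonneg fun _ _ => sq_nonneg _
  have hU0 : 0 ≤ ∑ a, u a ^ 2 := sum_nonneg fun _ _ => sq_nonneg _
  -- S = Σ_a u_a (M w)_a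
  have hSeq : S = ∑ a, u a * ∑ j, M a j * w j := by
    rw [hS]
    calc ∑ j, w j ^ 2 = ∑ j, w j * ∑ a, M a j * u a := Finset.sum_congr rfl fun j _ => by rw [sq, hw]
      _ = ∑ a, u a * ∑ j, M a j * w j := by
          simp_rw [Finset.mul_sum]
          rw [Finset.sum_comm]
          exact Finset.sum_congr rfl fun a _ => Finset.sum_congr rfl fun j _ => by ring
  -- S² ≤ (Σu²)(Σ (Mw)²) ≤ (Σu²) ε² S
  have h1 : S ^ 2 ≤ (∑ a, u a ^ 2) * (ε ^ 2 * S) := by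
    rw [hSeq]
    refine (Finset.sum_mul_sq_le_sq_mul_sq Finset.univ u fun a => ∑ j, M a j * w j).trans ?_
    rw [← hSeq]
    exact mul_le_mul_of_nonneg_left (hM w) hU0
  -- hence S ≤ ε² Σu²
  show S ≤ ε ^ 2 * ∑ a, u a ^ 2
  rcases eq_or_lt_of_le hS0 with h0 | hpos
  · rw [← h0]; positivity
  · nlinarith

/-- **Square-root-free Minkowski**: `ΣX² ≤ A²`, `ΣY² ≤ B²`, `A, B ≥ 0` ⟹ `Σ(X+Y)² ≤ (A+B)²`. [folklore] -/
theorem ns_add_le {X Y : Cp → ℝ} {A B : ℝ} (hA : 0 ≤ A) (hB : 0 ≤ B) (hX : ∑ a, X a ^ 2 ≤ A ^ 2)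
    (hY : ∑ a, Y a ^ 2 ≤ B ^ 2) : ∑ a, (X a + Y a) ^ 2 ≤ (A + B) ^ 2 := by
  have hcs := Real.sum_mul_le_sqrt_mul_sqrt Finset.univ X Y
  have hXs : Real.sqrt (∑ a, X a ^ 2) ≤ A := (Real.sqrt_le_sqrt hX).trans (le_of_eq (Real.sqrt_sq hA))
  have hYs : Real.sqrt (∑ a, Y a ^ 2) ≤ B := (Real.sqrt_le_sqrt hY).trans (le_of_eq (Real.sqrt_sq hB))
  have hXY : ∑ a, X a * Y a ≤ A * B :=
    hcs.trans (mul_le_mul hXs hYs (Real.sqrt_nonneg _) hA)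
  calc ∑ a, (X a + Y a) ^ 2 = ∑ a, X a ^ 2 + 2 * ∑ a, X a * Y a + ∑ a, Y a ^ 2 := by
        rw [Finset.mul_sum, ← Finset.sum_add_distrib, ← Finset.sum_add_distrib]
        exact Finset.sum_congr rfl fun a _ => by ring
    _ ≤ A ^ 2 + 2 * (A * B) + B ^ 2 := by linarith
    _ = (A + B) ^ 2 := by ring

/-- The transpose of a matrix with orthonormal columns is again an isometry on vectors:
`Σ_j (Σ_a P_{aj} u_a)² = Σ u²` (rows orthonormal, `B9Thm37GlueTorusRW.rows_orth`). [folklore] -/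
theorem sum_sq_orth_apply_transpose [DecidableEq Cp] {P : Cp → Cp → ℝ}
    (hP : ∀ i i', ∑ k, P k i * P k i' = if i = i' then (1 : ℝ) else 0) (u : Cp → ℝ) :
    ∑ j, (∑ a, P a j * u a) ^ 2 = ∑ a, u a ^ 2 :=
  sum_sq_orth_apply (P := fun j a => P a j) (fun i i' => rows_orth hP i i') u

/-! ## §2 The comb objects and the one-step identity -/

section CombStep

variable [DecidableEq Cp] {St Bd B : Type} {src tgt : Bd → St} (K : Comb src tgt B) (Rm : Bd → Cp → Cp → ℝ) (g : St → Cp → Cp → ℝ)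

/-- The gauge-comparison matrix along the comb: `D(x)_{aj} = Σ_k g(x)_{ak} tr(x)_{jk} − g(base(blk x))_{aj}` — part (E)'s
`cmpD` with `T = tr`, `O = g(base)`. [cite: Balaban1985BackgroundPropagators, (3.19) p.393] -/
def cmpC (x : St) (a j : Cp) : ℝ := ∑ k, g x a k * K.tr Rm x j k - g (K.base (K.blk x)) a j

/-- The gauged comb-bond variable of the bond `parent x → x` in part (B)'s `hol` shape:
`h_x_{ca} = Σ_m Σ_k g(parent x)_{cm} Rm(pbond x)_{mk} g(x)_{ak}`. [cite: Balaban1985BackgroundPropagators, (3.35) p.396] -/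
def gbond (x : St) (c a : Cp) : ℝ := ∑ m, ∑ k, g (K.parent x) c m * Rm (K.pbond x) m k * g x a k

omit [DecidableEq Cp] in
/-- The gauged comb-bond variable is the product `(g(parent)·Rm)·g(x)ᵀ` of component matrices. [folklore] -/
theorem gbond_eq_mmul (x : St) (c a : Cp) :
    gbond K Rm g x c a = mmul (mmul (g (K.parent x)) (Rm (K.pbond x))) (fun k a => g x a k) c a := by
  rw [gbond, mmul_apply, Finset.sum_comm]
  refine Finset.sum_congr rfl fun k _ => ?_
  rw [mmul_apply, Finset.sum_mul]

/-- The gauged comb-bond variable has orthonormal columns (product of isometries; `g(x)ᵀ` is one by `rows_orth`). [folklore] -/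
theorem gbond_orth (hRm : ∀ b i j, ∑ k, Rm b k i * Rm b k j = if i = j then (1 : ℝ) else 0)
    (hg : ∀ x i j, ∑ k, g x k i * g x k j = if i = j then (1 : ℝ) else 0) (x : St) (i j : Cp) :
    ∑ c, gbond K Rm g x c i * gbond K Rm g x c j = if i = j then (1 : ℝ) else 0 := by
  have h := mmul_orth (mmul_orth (hg (K.parent x)) (hRm (K.pbond x))) (fun i' j' => rows_orth (hg x) i' j') i j
  simpa only [gbond_eq_mmul] using h

/-- At a base point the comparison matrix vanishes. [folklore] -/
theorem cmpC_of_depth_eq_zero {x : St} (hx : K.depth x = 0) (a j : Cp) : cmpC K Rm g x a j = 0 := by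
  rw [cmpC]
  simp_rw [K.tr_of_depth_eq_zero Rm hx]
  rw [Finset.sum_eq_single j (fun k _ hk => by rw [if_neg (Ne.symm hk), mul_zero]) (fun h => absurd (mem_univ j) h),
    if_pos rfl, mul_one, ← congrArg g (K.eq_base x hx), sub_self]

/-- **The one-step identity**: at positive depth, with `p = parent x`,
`D(x)_{aj} = Σ_c h_x_{ca}·D(p)_{cj} + (Σ_c h_x_{ca}·g(base)_{cj} − g(base)_{aj})` — i.e. `D(x) = h_xᵀ·D(p) + (h_xᵀ − 1)·g(base)`
(insert `1 = g(p)ᵀg(p)` between `Rm` and `tr(p)`). [folklore] -/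
theorem cmpC_step (hg : ∀ x i j, ∑ k, g x k i * g x k j = if i = j then (1 : ℝ) else 0) {x : St} (hx : K.depth x ≠ 0)
    (a j : Cp) :
    cmpC K Rm g x a j = ∑ c, gbond K Rm g x c a * cmpC K Rm g (K.parent x) c j +
      (∑ c, gbond K Rm g x c a * g (K.base (K.blk x)) c j - g (K.base (K.blk x)) a j) := by
  set p := K.parent x with hp
  have hblk : K.base (K.blk p) = K.base (K.blk x) := by rw [hp, K.blk_parent x hx]
  -- expand both sides to the common expression  Σ_c h_{ca} · (Σ_m g p c m tr p j m)
  have hL : cmpC K Rm g x a j + g (K.base (K.blk x)) a j =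
      ∑ c, gbond K Rm g x c a * ∑ m, g p c m * K.tr Rm p j m := by
    rw [cmpC, sub_add_cancel]
    -- Σ_k g x a k tr x j k with tr x j k = Σ_m tr p j m Rm m k
    calc ∑ k, g x a k * K.tr Rm x j k
        = ∑ k, g x a k * ∑ m, K.tr Rm p j m * Rm (K.pbond x) m k :=
          Finset.sum_congr rfl fun k _ => by rw [K.tr_of_depth_ne_zero Rm hx]
      _ = ∑ m, (∑ k, g x a k * Rm (K.pbond x) m k) * K.tr Rm p j m := by
          simp_rw [Finset.mul_sum]
          rw [Finset.sum_comm]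
          refine Finset.sum_congr rfl fun m _ => ?_
          rw [Finset.sum_mul]
          exact Finset.sum_congr rfl fun k _ => by ring
      _ = ∑ m, (∑ k, g x a k * Rm (K.pbond x) m k) *
            ∑ c, g p c m * ∑ m', g p c m' * K.tr Rm p j m' := by
          refine Finset.sum_congr rfl fun m _ => ?_
          rw [orth_cancel (hg p) (fun m' => K.tr Rm p j m') m]
      _ = ∑ m, ∑ c, (∑ k, g x a k * Rm (K.pbond x) m k) * g p c m * ∑ m', g p c m' * K.tr Rm p j m' := by
          refine Finset.sum_congr rfl fun m _ => ?_
          rw [Finset.mul_sum]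
          exact Finset.sum_congr rfl fun c _ => by ring
      _ = ∑ c, ∑ m, (∑ k, g x a k * Rm (K.pbond x) m k) * g p c m * ∑ m', g p c m' * K.tr Rm p j m' :=
          Finset.sum_comm
      _ = ∑ c, gbond K Rm g x c a * ∑ m, g p c m * K.tr Rm p j m := by
          refine Finset.sum_congr rfl fun c _ => ?_
          rw [← Finset.sum_mul]
          congr 1
          rw [gbond]
          refine Finset.sum_congr rfl fun m _ => ?_
          rw [Finset.sum_mul]
          exact Finset.sum_congr rfl fun k _ => by rw [← hp]; ring
  have hR : ∑ c, gbond K Rm g x c a * cmpC K Rm g p c j + ∑ c, gbond K Rm g x c a * g (K.base (K.blk x)) c j =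
      ∑ c, gbond K Rm g x c a * ∑ m, g p c m * K.tr Rm p j m := by
    rw [← Finset.sum_add_distrib]
    refine Finset.sum_congr rfl fun c _ => ?_
    rw [cmpC, hblk]
    ring
  linarith

end CombStep

/-! ## §3 The END: the comparison datum grows at most linearly in the depth -/

section End

variable [DecidableEq Cp] {St Bd B : Type} {src tgt : Bd → St} (K : Comb src tgt B) (Rm : Bd → Cp → Cp → ℝ) (g : St → Cp → Cp → ℝ)

/-- **THE GAUGE-COMPARISON DATUM ALONG A COMB (MODEL).**  Orthogonal bond matrices and gauge, and gauged comb-bond variables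
`ε`-close to `1` in the quadratic-form shape of part (B)∕(E) (`‖(h_x − 1)w‖ ≤ ε‖w‖` for every site of positive depth):
`Σ_a(Σ_j D(x)_{aj} u_j)² ≤ (depth(x)·ε)²·Σ_j u_j²` with `D(x) = g(x)·tr(x)ᵀ − g(base)`.
[cite: Balaban1985BackgroundPropagators, (3.19) p.393 + (3.35) p.396] -/
theorem cmpC_le_depth (hRm : ∀ b i j, ∑ k, Rm b k i * Rm b k j = if i = j then (1 : ℝ) else 0)
    (hg : ∀ x i j, ∑ k, g x k i * g x k j = if i = j then (1 : ℝ) else 0) {ε : ℝ} (hε : 0 ≤ ε)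
    (hgauge : ∀ x, K.depth x ≠ 0 → ∀ w : Cp → ℝ,
      ∑ c, (∑ a, (gbond K Rm g x c a - if c = a then 1 else 0) * w a) ^ 2 ≤ ε ^ 2 * ∑ a, w a ^ 2)
    (x : St) (u : Cp → ℝ) :
    ∑ a, (∑ j, cmpC K Rm g x a j * u j) ^ 2 ≤ (K.depth x * ε) ^ 2 * ∑ j, u j ^ 2 := by
  suffices h : ∀ d x, K.depth x = d → ∀ u : Cp → ℝ,
      ∑ a, (∑ j, cmpC K Rm g x a j * u j) ^ 2 ≤ (d * ε) ^ 2 * ∑ j, u j ^ 2 by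
    have := h _ x rfl u
    simpa using this
  intro d
  induction d with
  | zero =>
      intro x hx u
      have h0 : ∀ a, ∑ j, cmpC K Rm g x a j * u j = 0 := fun a =>
        Finset.sum_eq_zero fun j _ => by rw [cmpC_of_depth_eq_zero K Rm g hx, zero_mul]
      simp [h0]
  | succ d ih =>
      intro x hx u
      have hx0 : K.depth x ≠ 0 := by omega
      set p := K.parent x with hp
      have hdp : K.depth p = d := by have := K.depth_parent x hx0; rw [← hp] at this; omega
      set O : Cp → Cp → ℝ := g (K.base (K.blk x)) with hO
      have hOorth : ∀ i i', ∑ k, O k i * O k i' = if i = i' then (1 : ℝ) else 0 := hg _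
      -- the two pieces
      set X : Cp → ℝ := fun a => ∑ c, gbond K Rm g x c a * ∑ j, cmpC K Rm g p c j * u j with hX
      set Y : Cp → ℝ := fun a => ∑ c, (gbond K Rm g x c a - if c = a then 1 else 0) * ∑ j, O c j * u j with hY
      have hsplit : ∀ a, ∑ j, cmpC K Rm g x a j * u j = X a + Y a := by
        intro a
        rw [hX, hY]
        simp only
        calc ∑ j, cmpC K Rm g x a j * u j
            = ∑ j, (∑ c, gbond K Rm g x c a * cmpC K Rm g p c j +
                (∑ c, gbond K Rm g x c a * O c j - O a j)) * u j :=
              Finset.sum_congr rfl fun j _ => by rw [cmpC_step K Rm g hg hx0 a j]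
          _ = ∑ j, ((∑ c, gbond K Rm g x c a * cmpC K Rm g p c j) * u j) +
                ∑ j, ((∑ c, (gbond K Rm g x c a - if c = a then 1 else 0) * O c j) * u j) := by
              rw [← Finset.sum_add_distrib]
              refine Finset.sum_congr rfl fun j _ => ?_
              have : ∑ c, (gbond K Rm g x c a - if c = a then 1 else 0) * O c j =
                  ∑ c, gbond K Rm g x c a * O c j - O a j := by
                simp_rw [sub_mul]
                rw [Finset.sum_sub_distrib]
                congr 1
                rw [Finset.sum_eq_single a (fun c _ hc => by rw [if_neg hc, zero_mul])
                  (fun h => absurd (mem_univ a) h), if_pos rfl, one_mul]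
              rw [this]
              ring
          _ = (∑ c, gbond K Rm g x c a * ∑ j, cmpC K Rm g p c j * u j) +
                ∑ c, (gbond K Rm g x c a - if c = a then 1 else 0) * ∑ j, O c j * u j := by
              congr 1
              · simp_rw [Finset.sum_mul, Finset.mul_sum]
                rw [Finset.sum_comm]
                exact Finset.sum_congr rfl fun c _ => Finset.sum_congr rfl fun j _ => by ring
              · simp_rw [Finset.sum_mul, Finset.mul_sum]
                rw [Finset.sum_comm]
                exact Finset.sum_congr rfl fun c _ => Finset.sum_congr rfl fun j _ => by ring
      -- ‖X‖ = ‖D(p)u‖ ≤ dε‖u‖ (transposed isometry of the gauged bond variable + induction hypothesis)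
      have hU0 : 0 ≤ ∑ j, u j ^ 2 := sum_nonneg fun _ _ => sq_nonneg _
      have hXsq : ∑ a, X a ^ 2 ≤ (d * ε * Real.sqrt (∑ j, u j ^ 2)) ^ 2 := by
        rw [hX, sum_sq_orth_apply_transpose (gbond_orth K Rm g hRm hg x)]
        refine (ih p hdp u).trans (le_of_eq ?_)
        rw [mul_pow ((d : ℝ) * ε) (Real.sqrt _) 2, Real.sq_sqrt hU0]
      -- ‖Y‖ ≤ ε‖Ou‖ = ε‖u‖ (transpose defect + isometry of O)
      have hYsq : ∑ a, Y a ^ 2 ≤ (ε * Real.sqrt (∑ j, u j ^ 2)) ^ 2 := by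
        rw [hY]
        refine (transpose_defect_le (hgauge x hx0) (fun c => ∑ j, O c j * u j)).trans (le_of_eq ?_)
        rw [sum_sq_orth_apply hOorth u, mul_pow ε (Real.sqrt _) 2, Real.sq_sqrt hU0]
      have hd0 : (0 : ℝ) ≤ d := Nat.cast_nonneg d
      have hsq0 : 0 ≤ Real.sqrt (∑ j, u j ^ 2) := Real.sqrt_nonneg _
      calc ∑ a, (∑ j, cmpC K Rm g x a j * u j) ^ 2 = ∑ a, (X a + Y a) ^ 2 :=
            Finset.sum_congr rfl fun a _ => by rw [hsplit]
        _ ≤ (d * ε * Real.sqrt (∑ j, u j ^ 2) + ε * Real.sqrt (∑ j, u j ^ 2)) ^ 2 :=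
            ns_add_le (by positivity) (by positivity) hXsq hYsq
        _ = (((d + 1 : ℕ) : ℝ) * ε) ^ 2 * ∑ j, u j ^ 2 := by
            rw [show (d : ℝ) * ε * Real.sqrt (∑ j, u j ^ 2) + ε * Real.sqrt (∑ j, u j ^ 2) =
                (((d + 1 : ℕ) : ℝ) * ε) * Real.sqrt (∑ j, u j ^ 2) by push_cast; ring,
              mul_pow, Real.sq_sqrt hU0]

/-- **The `hcmp` hypothesis of part (E) for a block charted into a comb block** (`δ = D·ε` for depth `≤ D`): for a chart
`φ` with `blk(φ v) = β` and `depth(φ v) ≤ D`,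
`Σ_a(Σ_j cmpD (v ↦ tr(φ v)) (v ↦ g(φ v)) (g(base β)) v a j · u_j)² ≤ (D·ε)²·Σu²`.
[cite: Balaban1985BackgroundPropagators, (3.19) p.393 + (3.35) p.396] -/
theorem hcmp_of_comb (hRm : ∀ b i j, ∑ k, Rm b k i * Rm b k j = if i = j then (1 : ℝ) else 0)
    (hg : ∀ x i j, ∑ k, g x k i * g x k j = if i = j then (1 : ℝ) else 0) {ε : ℝ} (hε : 0 ≤ ε)
    (hgauge : ∀ x, K.depth x ≠ 0 → ∀ w : Cp → ℝ,
      ∑ c, (∑ a, (gbond K Rm g x c a - if c = a then 1 else 0) * w a) ^ 2 ≤ ε ^ 2 * ∑ a, w a ^ 2)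
    {ν n : ℕ} (φ : Box ν n → St) (β : B) (hφβ : ∀ v, K.blk (φ v) = β) {D : ℕ} (hD : ∀ v, K.depth (φ v) ≤ D)
    (v : Box ν n) (u : Cp → ℝ) :
    ∑ a, (∑ j, cmpD (fun v => K.tr Rm (φ v)) (fun v => g (φ v)) (g (K.base β)) v a j * u j) ^ 2 ≤
      (D * ε) ^ 2 * ∑ j, u j ^ 2 := by
  have h := cmpC_le_depth K Rm g hRm hg hε hgauge (φ v) u
  have hcmp : ∀ a j, cmpD (fun v => K.tr Rm (φ v)) (fun v => g (φ v)) (g (K.base β)) v a j = cmpC K Rm g (φ v) a j := by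
    intro a j
    rw [cmpD, cmpC, hφβ v]
  simp_rw [hcmp]
  refine h.trans (mul_le_mul_of_nonneg_right ?_ (sum_nonneg fun _ _ => sq_nonneg _))
  have hle : (K.depth (φ v) : ℝ) * ε ≤ D * ε := mul_le_mul_of_nonneg_right (by exact_mod_cast hD v) hε
  have h0 : 0 ≤ (K.depth (φ v) : ℝ) * ε := by positivity
  exact pow_le_pow_left₀ h0 hle 2

/-- **Block-local form** (v1.1): the same bound for the sites of ONE block `β`, from the gauge hypothesis on the comb bonds of
that block only (the comb path of a site stays in its block, `Comb.blk_parent`). [cite: Balaban1985BackgroundPropagators, (3.19) p.393 + (3.35) p.396] -/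
theorem cmpC_le_depth_on (hRm : ∀ b i j, ∑ k, Rm b k i * Rm b k j = if i = j then (1 : ℝ) else 0)
    (hg : ∀ x i j, ∑ k, g x k i * g x k j = if i = j then (1 : ℝ) else 0) {ε : ℝ} (hε : 0 ≤ ε) (β : B)
    (hgauge : ∀ x, K.blk x = β → K.depth x ≠ 0 → ∀ w : Cp → ℝ,
      ∑ c, (∑ a, (gbond K Rm g x c a - if c = a then 1 else 0) * w a) ^ 2 ≤ ε ^ 2 * ∑ a, w a ^ 2)
    (x : St) (hxβ : K.blk x = β) (u : Cp → ℝ) :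
    ∑ a, (∑ j, cmpC K Rm g x a j * u j) ^ 2 ≤ (K.depth x * ε) ^ 2 * ∑ j, u j ^ 2 := by
  suffices h : ∀ d x, K.blk x = β → K.depth x = d → ∀ u : Cp → ℝ,
      ∑ a, (∑ j, cmpC K Rm g x a j * u j) ^ 2 ≤ (d * ε) ^ 2 * ∑ j, u j ^ 2 by
    have := h _ x hxβ rfl u
    simpa using this
  intro d
  induction d with
  | zero =>
      intro x _ hx u
      have h0 : ∀ a, ∑ j, cmpC K Rm g x a j * u j = 0 := fun a =>
        Finset.sum_eq_zero fun j _ => by rw [cmpC_of_depth_eq_zero K Rm g hx, zero_mul]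
      simp [h0]
  | succ d ih =>
      intro x hxb hx u
      have hx0 : K.depth x ≠ 0 := by omega
      set p := K.parent x with hp
      have hdp : K.depth p = d := by have := K.depth_parent x hx0; rw [← hp] at this; omega
      have hpb : K.blk p = β := by rw [hp, K.blk_parent x hx0]; exact hxb
      set O : Cp → Cp → ℝ := g (K.base (K.blk x)) with hO
      have hOorth : ∀ i i', ∑ k, O k i * O k i' = if i = i' then (1 : ℝ) else 0 := hg _
      set X : Cp → ℝ := fun a => ∑ c, gbond K Rm g x c a * ∑ j, cmpC K Rm g p c j * u j with hX
      set Y : Cp → ℝ := fun a => ∑ c, (gbond K Rm g x c a - if c = a then 1 else 0) * ∑ j, O c j * u j with hY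
      have hsplit : ∀ a, ∑ j, cmpC K Rm g x a j * u j = X a + Y a := by
        intro a
        rw [hX, hY]
        simp only
        calc ∑ j, cmpC K Rm g x a j * u j
            = ∑ j, (∑ c, gbond K Rm g x c a * cmpC K Rm g p c j +
                (∑ c, gbond K Rm g x c a * O c j - O a j)) * u j :=
              Finset.sum_congr rfl fun j _ => by rw [cmpC_step K Rm g hg hx0 a j]
          _ = ∑ j, ((∑ c, gbond K Rm g x c a * cmpC K Rm g p c j) * u j) +
                ∑ j, ((∑ c, (gbond K Rm g x c a - if c = a then 1 else 0) * O c j) * u j) := by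
              rw [← Finset.sum_add_distrib]
              refine Finset.sum_congr rfl fun j _ => ?_
              have : ∑ c, (gbond K Rm g x c a - if c = a then 1 else 0) * O c j =
                  ∑ c, gbond K Rm g x c a * O c j - O a j := by
                simp_rw [sub_mul]
                rw [Finset.sum_sub_distrib]
                congr 1
                rw [Finset.sum_eq_single a (fun c _ hc => by rw [if_neg hc, zero_mul])
                  (fun h => absurd (mem_univ a) h), if_pos rfl, one_mul]
              rw [this]
              ring
          _ = (∑ c, gbond K Rm g x c a * ∑ j, cmpC K Rm g p c j * u j) +
                ∑ c, (gbond K Rm g x c a - if c = a then 1 else 0) * ∑ j, O c j * u j := by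
              congr 1
              · simp_rw [Finset.sum_mul, Finset.mul_sum]
                rw [Finset.sum_comm]
                exact Finset.sum_congr rfl fun c _ => Finset.sum_congr rfl fun j _ => by ring
              · simp_rw [Finset.sum_mul, Finset.mul_sum]
                rw [Finset.sum_comm]
                exact Finset.sum_congr rfl fun c _ => Finset.sum_congr rfl fun j _ => by ring
      have hU0 : 0 ≤ ∑ j, u j ^ 2 := sum_nonneg fun _ _ => sq_nonneg _
      have hXsq : ∑ a, X a ^ 2 ≤ (d * ε * Real.sqrt (∑ j, u j ^ 2)) ^ 2 := by
        rw [hX, sum_sq_orth_apply_transpose (gbond_orth K Rm g hRm hg x)]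
        refine (ih p hpb hdp u).trans (le_of_eq ?_)
        rw [mul_pow ((d : ℝ) * ε) (Real.sqrt _) 2, Real.sq_sqrt hU0]
      have hYsq : ∑ a, Y a ^ 2 ≤ (ε * Real.sqrt (∑ j, u j ^ 2)) ^ 2 := by
        rw [hY]
        refine (transpose_defect_le (hgauge x hxb hx0) (fun c => ∑ j, O c j * u j)).trans (le_of_eq ?_)
        rw [sum_sq_orth_apply hOorth u, mul_pow ε (Real.sqrt _) 2, Real.sq_sqrt hU0]
      calc ∑ a, (∑ j, cmpC K Rm g x a j * u j) ^ 2 = ∑ a, (X a + Y a) ^ 2 :=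
            Finset.sum_congr rfl fun a _ => by rw [hsplit]
        _ ≤ (d * ε * Real.sqrt (∑ j, u j ^ 2) + ε * Real.sqrt (∑ j, u j ^ 2)) ^ 2 :=
            ns_add_le (by positivity) (by positivity) hXsq hYsq
        _ = (((d + 1 : ℕ) : ℝ) * ε) ^ 2 * ∑ j, u j ^ 2 := by
            rw [show (d : ℝ) * ε * Real.sqrt (∑ j, u j ^ 2) + ε * Real.sqrt (∑ j, u j ^ 2) =
                (((d + 1 : ℕ) : ℝ) * ε) * Real.sqrt (∑ j, u j ^ 2) by push_cast; ring,
              mul_pow, Real.sq_sqrt hU0]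

/-- **Block-local chart form** (v1.1): the `hcmp` hypothesis of part (E)∕(F) with `δ = D·ε` for a chart into the block `β`, from the
gauge hypothesis on the comb bonds of `β` only. [cite: Balaban1985BackgroundPropagators, (3.19) p.393 + (3.35) p.396] -/
theorem hcmp_of_comb_on (hRm : ∀ b i j, ∑ k, Rm b k i * Rm b k j = if i = j then (1 : ℝ) else 0)
    (hg : ∀ x i j, ∑ k, g x k i * g x k j = if i = j then (1 : ℝ) else 0) {ε : ℝ} (hε : 0 ≤ ε) (β : B)
    (hgauge : ∀ x, K.blk x = β → K.depth x ≠ 0 → ∀ w : Cp → ℝ,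
      ∑ c, (∑ a, (gbond K Rm g x c a - if c = a then 1 else 0) * w a) ^ 2 ≤ ε ^ 2 * ∑ a, w a ^ 2)
    {ν n : ℕ} (φ : Box ν n → St) (hφβ : ∀ v, K.blk (φ v) = β) {D : ℕ} (hD : ∀ v, K.depth (φ v) ≤ D)
    (v : Box ν n) (u : Cp → ℝ) :
    ∑ a, (∑ j, cmpD (fun v => K.tr Rm (φ v)) (fun v => g (φ v)) (g (K.base β)) v a j * u j) ^ 2 ≤
      (D * ε) ^ 2 * ∑ j, u j ^ 2 := by
  have h := cmpC_le_depth_on K Rm g hRm hg hε β hgauge (φ v) (hφβ v) u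
  have hcmp : ∀ a j, cmpD (fun v => K.tr Rm (φ v)) (fun v => g (φ v)) (g (K.base β)) v a j = cmpC K Rm g (φ v) a j := by
    intro a j
    rw [cmpD, cmpC, hφβ v]
  simp_rw [hcmp]
  refine h.trans (mul_le_mul_of_nonneg_right ?_ (sum_nonneg fun _ _ => sq_nonneg _))
  have hle : (K.depth (φ v) : ℝ) * ε ≤ D * ε := mul_le_mul_of_nonneg_right (by exact_mod_cast hD v) hε
  have h0 : 0 ≤ (K.depth (φ v) : ℝ) * ε := by positivity
  exact pow_le_pow_left₀ h0 hle 2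

end End

end

end Summit.QuantumFields.BalabanUV.Beta.CombGaugeComparison
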